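import Literature.NumberTheory.NumberFields.NFIsoLocalFactors
import HarnessLib

/-!
# Complete factorisation modulo `ℓ` with syntactic size caps (machine form of `localFactors`)

Support file for the discharge of the named fact
`Literature.NumberTheory.NumberFields.nfIso_mem_P` (number-field isomorphism is in `P`;
Landau 1985, A. K. Lenstra 1983 Thm. (3.7)). The complete factorisation `localFactors ℓ f` of
`NFIsoLocalFactors.lean` (LLL82 (3.1): repeated Berlekamp splitting) is a fold whose accumulator
must stay polynomially bounded on EVERY input for the `CodeFP` realisation (`CodeFP.foldl`), not
only on the normal monic squarefree inputs of its specification. This file defines the variant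
`localFactorsCap`, in which every factor returned by `berlekampFactor` and every quotient is
reduced modulo `ℓ` and truncated to the current length (`capList`) — operations that are the
IDENTITY along every run covered by the specification — and proves

* `pnorm_eq_self_of_normal`, `capList_eq_self`;
* `lfRunCap_eq` / **`localFactorsCap_eq`**: on a normal list with monic squarefree polynomial of
  degree `|f| - 1` (and `ℓ` prime), `localFactorsCap ℓ f = localFactors ℓ f`;
* the transferred specification `localFactorsCap_spec`, `exists_mem_localFactorsCap_dvd`;
* the unconditional size invariants `length_lfRunCap_fst_le`, `lfRunCap_fst_reduced_or_eq`,
  `mem_lfRunCap_snd` (every collected factor is reduced modulo `ℓ` and not longer than `f`),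
  `length_lfRunCap_snd_le` — the inputs of the accumulator estimate of the sequel `FP` file.

## References

* A. K. Lenstra, H. W. Lenstra Jr., L. Lovász, *Factoring polynomials with rational coefficients*,
  Math. Ann. 261 (1982) 515–534, §3, (3.1). [LenstraLenstraLovasz1982]
* D. E. Knuth, *The Art of Computer Programming*, Vol. 2, 3rd ed., §4.6.2, Algorithm B. [KnuthTAOCP2]
* S. Arora, B. Barak, *Computational Complexity: A Modern Approach*, CUP 2009, §1.3 (polynomially
  bounded loops). [AroraBarak2009]
-/

open Polynomial

namespace Literature.NumberTheory.NumberFields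

open Literature.Computability.Complexity Literature.Computability.Complexity.LLLFactoring
open Literature.Computability.Complexity.SumcheckMA

/-! ### The capped program -/

/-- Reduce modulo `P`, trim, and keep at most `k` entries. [folklore] -/
def capList (P k : ℕ) (l : List ℤ) : List ℤ := (pnorm P l).take k

/-- One capped extraction step: as `lfStep`, with the factor and the quotient passed through
`capList P |W|`. [cite: KnuthTAOCP2, §4.6.2, Algorithm B] [cite: LenstraLenstraLovasz1982, (3.1)] -/
def lfStepCap (P : ℕ) (st : List ℤ × List (List ℤ)) : List ℤ × List (List ℤ) :=
  if st.1.length < 2 then st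
  else
    (capList P st.1.length (pdivmod P st.1 (capList P st.1.length (berlekampFactor P st.1))).1,
      capList P st.1.length (berlekampFactor P st.1) :: st.2)

/-- The capped run of `k` steps from `(f, [])`. [cite: KnuthTAOCP2, §4.6.2, Algorithm B] -/
def lfRunCap (P : ℕ) (f : List ℤ) (k : ℕ) : List ℤ × List (List ℤ) :=
  (List.replicate k ()).foldl (fun st _ => lfStepCap P st) (f, [])

/-- **The capped complete factorisation modulo `P`** (the program realised on codes).
[cite: LenstraLenstraLovasz1982, (3.1)] -/
def localFactorsCap (P : ℕ) (f : List ℤ) : List (List ℤ) := (lfRunCap P f f.length).2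

/-- Unfolding of the run. [folklore] -/
theorem lfRunCap_succ (P : ℕ) (f : List ℤ) (k : ℕ) : lfRunCap P f (k + 1) = lfStepCap P (lfRunCap P f k) := by
  rw [lfRunCap, List.replicate_succ', List.foldl_append, List.foldl_cons, List.foldl_nil, ← lfRunCap]

/-- The run starts at `(f, [])`. [folklore] -/
theorem lfRunCap_zero (P : ℕ) (f : List ℤ) : lfRunCap P f 0 = (f, []) := rfl

/-! ### The caps are the identity on normal short lists -/

/-- Reduction modulo `P` does not change a reduced list. [folklore] -/
theorem pmod_eq_self_of_reduced {P : ℕ} {a : List ℤ} (h : Reduced P a) : pmod P a = a := by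
  unfold pmod
  conv_rhs => rw [← List.map_id a]
  refine List.map_congr_left fun c hc => ?_
  obtain ⟨h0, hlt⟩ := h c hc
  exact Int.emod_eq_of_lt h0 hlt

/-- `pnorm` does not change a normal list. [folklore] -/
theorem pnorm_eq_self_of_normal {P : ℕ} {a : List ℤ} (h : Normal P a) : pnorm P a = a := by
  rw [pnorm, pmod_eq_self_of_reduced h.1, h.2]

/-- `capList P k` does not change a normal list of length `≤ k`. [folklore] -/
theorem capList_eq_self {P k : ℕ} {a : List ℤ} (h : Normal P a) (hk : a.length ≤ k) : capList P k a = a := by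
  rw [capList, pnorm_eq_self_of_normal h, List.take_of_length_le hk]

section Spec

variable {ℓ : ℕ} [hℓ : Fact ℓ.Prime]

/-- **Along a valid run the caps are idle**: `lfRunCap ℓ f k = lfRun ℓ f k` for `f` normal with
monic squarefree polynomial of degree `|f| - 1`. [cite: LenstraLenstraLovasz1982, (3.1)] -/
theorem lfRunCap_eq {f : List ℤ} (hfn : Normal ℓ f) (hfm : (toZMod ℓ f).Monic)
    (hfd : (toZMod ℓ f).natDegree = f.length - 1) (hsqf : Squarefree (toZMod ℓ f)) :
    ∀ k : ℕ, lfRunCap ℓ f k = lfRun ℓ f k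
  | 0 => rfl
  | k + 1 => by
    rw [lfRunCap_succ, lfRun_succ, lfRunCap_eq hfn hfm hfd hsqf k]
    obtain ⟨hinv, -⟩ := lfRun_spec hfn hfm hfd hsqf k
    set st := lfRun ℓ f k with hst
    obtain ⟨W, acc⟩ := st
    obtain ⟨hWn, hWm, hWd, hW1, hWf, hprod, hacc, hcount⟩ := hinv
    dsimp only at hWn hWm hWd hW1 hWf hprod hcount
    by_cases hlt : W.length < 2
    · rw [lfStepCap, lfStep, if_pos hlt, if_pos hlt]
    · have h2 : 2 ≤ W.length := by omega
      have hWdvd : toZMod ℓ W ∣ toZMod ℓ f := ⟨_, hprod.symm⟩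
      have hsqW : Squarefree (toZMod ℓ W) := hsqf.squarefree_of_dvd hWdvd
      obtain ⟨hun, hum, hud, huirr, hudvd, hu2, hulen⟩ := berlekampFactor_spec hWn hWm hWd h2 hsqW
      have hcapu : capList ℓ W.length (berlekampFactor ℓ W) = berlekampFactor ℓ W := capList_eq_self hun hulen
      -- the quotient is short, so its cap is idle too
      obtain ⟨-, hdec, -⟩ := lfStep_spec hsqf (st := (W, acc)) ⟨hWn, hWm, hWd, hW1, hWf, hprod, hacc, hcount⟩
      have hq := hdec h2
      rw [lfStep, if_neg hlt] at hq
      dsimp only at hq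
      have hqn : Normal ℓ (pdivM ℓ W (berlekampFactor ℓ W)) := normal_pnorm hℓ.out.pos _
      have hcapq : capList ℓ W.length (pdivmod ℓ W (berlekampFactor ℓ W)).1 = pdivM ℓ W (berlekampFactor ℓ W) := by
        rw [capList, ← pdivM, List.take_of_length_le (by omega)]
      rw [lfStepCap, lfStep, if_neg hlt, if_neg hlt]
      dsimp only
      rw [hcapu, hcapq]

/-- **`localFactorsCap = localFactors` on valid input.** [cite: LenstraLenstraLovasz1982, (3.1)] -/
theorem localFactorsCap_eq {f : List ℤ} (hfn : Normal ℓ f) (hfm : (toZMod ℓ f).Monic)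
    (hfd : (toZMod ℓ f).natDegree = f.length - 1) (hsqf : Squarefree (toZMod ℓ f)) :
    localFactorsCap ℓ f = localFactors ℓ f := by
  rw [localFactorsCap, localFactors, lfRunCap_eq hfn hfm hfd hsqf]

/-- **Specification of the capped complete factorisation** (transferred from `localFactors_spec`).
[cite: LenstraLenstraLovasz1982, (3.1)] [cite: KnuthTAOCP2, §4.6.2, Algorithm B] -/
theorem localFactorsCap_spec {f : List ℤ} (hfn : Normal ℓ f) (hfm : (toZMod ℓ f).Monic)
    (hfd : (toZMod ℓ f).natDegree = f.length - 1) (hsqf : Squarefree (toZMod ℓ f)) :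
    (∀ u ∈ localFactorsCap ℓ f, Normal ℓ u ∧ (toZMod ℓ u).Monic ∧
        (toZMod ℓ u).natDegree = u.length - 1 ∧ Irreducible (toZMod ℓ u) ∧
        2 ≤ u.length ∧ u.length ≤ f.length) ∧
      ((localFactorsCap ℓ f).map (toZMod ℓ)).prod = toZMod ℓ f ∧
      (localFactorsCap ℓ f).length ≤ f.length := by
  rw [localFactorsCap_eq hfn hfm hfd hsqf]
  exact localFactors_spec hfn hfm hfd hsqf

/-- **Completeness of the capped complete factorisation** (transferred). [cite: LenstraLenstraLovasz1982, (3.1) and Prop. (2.5)] -/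
theorem exists_mem_localFactorsCap_dvd {f : List ℤ} (hfn : Normal ℓ f) (hfm : (toZMod ℓ f).Monic)
    (hfd : (toZMod ℓ f).natDegree = f.length - 1) (hsqf : Squarefree (toZMod ℓ f))
    {ρ : (ZMod ℓ)[X]} (hρ : Irreducible ρ) (hρf : ρ ∣ toZMod ℓ f) :
    ∃ u ∈ localFactorsCap ℓ f, toZMod ℓ u ∣ ρ := by
  rw [localFactorsCap_eq hfn hfm hfd hsqf]
  exact exists_mem_localFactors_dvd hfn hfm hfd hsqf hρ hρf

end Spec

/-! ### Unconditional size invariants -/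

/-- A capped list is short. [folklore] -/
theorem length_capList_le (P k : ℕ) (l : List ℤ) : (capList P k l).length ≤ k := by
  rw [capList, List.length_take]; exact min_le_left _ _

/-- A capped list is reduced modulo `P ≥ 1`. [folklore] -/
theorem reduced_capList {P : ℕ} (hP : 0 < P) (k : ℕ) (l : List ℤ) : Reduced P (capList P k l) :=
  (normal_pnorm hP l).1.of_subset (List.take_subset _ _)

/-- The cofactor never gets longer than `f`. [folklore] -/
theorem length_lfRunCap_fst_le (P : ℕ) (f : List ℤ) : ∀ k : ℕ, (lfRunCap P f k).1.length ≤ f.length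
  | 0 => le_rfl
  | k + 1 => by
    rw [lfRunCap_succ]
    have ih := length_lfRunCap_fst_le P f k
    set st := lfRunCap P f k
    by_cases hlt : st.1.length < 2
    · rw [lfStepCap, if_pos hlt]; exact ih
    · rw [lfStepCap, if_neg hlt]
      exact (length_capList_le _ _ _).trans ih

/-- The cofactor is either the input `f` itself or reduced modulo `P ≥ 1`. [folklore] -/
theorem lfRunCap_fst_reduced_or_eq {P : ℕ} (hP : 0 < P) (f : List ℤ) :
    ∀ k : ℕ, (lfRunCap P f k).1 = f ∨ Reduced P (lfRunCap P f k).1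
  | 0 => Or.inl rfl
  | k + 1 => by
    rw [lfRunCap_succ]
    have ih := lfRunCap_fst_reduced_or_eq hP f k
    set st := lfRunCap P f k
    by_cases hlt : st.1.length < 2
    · rw [lfStepCap, if_pos hlt]; exact ih
    · rw [lfStepCap, if_neg hlt]
      exact Or.inr (reduced_capList hP _ _)

/-- Every collected factor is reduced modulo `P ≥ 1` and at most as long as `f`. [folklore] -/
theorem mem_lfRunCap_snd {P : ℕ} (hP : 0 < P) (f : List ℤ) :
    ∀ (k : ℕ), ∀ u ∈ (lfRunCap P f k).2, Reduced P u ∧ u.length ≤ f.length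
  | 0 => fun u hu => absurd hu List.not_mem_nil
  | k + 1 => by
    intro u hu
    rw [lfRunCap_succ] at hu
    have ih := mem_lfRunCap_snd hP f k
    have hlen := length_lfRunCap_fst_le P f k
    set st := lfRunCap P f k
    by_cases hlt : st.1.length < 2
    · rw [lfStepCap, if_pos hlt] at hu; exact ih u hu
    · rw [lfStepCap, if_neg hlt] at hu
      rcases List.mem_cons.1 hu with rfl | hu
      · exact ⟨reduced_capList hP _ _, (length_capList_le _ _ _).trans hlen⟩
      · exact ih u hu

/-- At most one factor is collected per step. [folklore] -/
theorem length_lfRunCap_snd_le (P : ℕ) (f : List ℤ) : ∀ k : ℕ, (lfRunCap P f k).2.length ≤ k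
  | 0 => le_rfl
  | k + 1 => by
    rw [lfRunCap_succ]
    have ih := length_lfRunCap_snd_le P f k
    set st := lfRunCap P f k
    by_cases hlt : st.1.length < 2
    · rw [lfStepCap, if_pos hlt]; exact ih.trans (Nat.le_succ k)
    · rw [lfStepCap, if_neg hlt]
      exact Nat.succ_le_succ ih

end Literature.NumberTheory.NumberFields
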